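import Mathlib.RepresentationTheory.Maschke
import Summits.HodgeConjecture.HodgeConjecture.Theorems.SoloBlindLocalTransport
import Literature.AlgebraicGeometry.HodgeTheory.ComplexConjugationHolds
import HarnessLib

/-!
# A reflection principle for Hodge classes: the algebraic core, kernel-checked

Solo-blind residency on `HodgeConjecture`, session s6. Companion prose: the residency's
`paper/reflection-principle.md` (s5), claims SB-C28 – SB-C31 of its `CLAIMS.jsonl`.

## The principle (mathematics; what is and is not formalised here)

Let `X ⊂ ℙ⁵` be a smooth sextic fourfold and `g ∈ Aut(X)` be induced by a pseudo-reflection of `ℂ⁶`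
of order `m ∈ {2, 3, 6}`. Three elementary geometric facts (NOT formalised — the tree has no
weighted projective spaces, finite quotients or push-forwards on Betti cohomology):

* **Lemma 1.** In eigen-coordinates `F = G(u, vᵐ)`, the isolated fixed point of `g` is never on `X`
  (`G(u, 1)` has no linear part in `u`, so it would be a singular point), `X` is transversal to the
  mirror hyperplane, and `X/⟨g⟩ = {G = 0} ⊂ ℙ(1,1,1,1,1,m)` is a SMOOTH FANO fourfold,
  `K = 𝒪(1 - m)` (Chevalley–Shephard–Todd + adjunction; cross-checked by Riemann–Hurwitz).
* **Lemma 2.** A smooth Fano fourfold is uniruled (Mori; Campana, Kollár–Miyaoka–Mori), and the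
  Hodge conjecture holds for smooth projective uniruled fourfolds (Conte–Murre 1978, via the
  Bloch–Srinivas decomposition of the diagonal [arXiv:math/0502257, p. 1, Lemma 1;
  arXiv:0706.2506, p. 8, Cor. 26]).
* **Lemma 3.** Hence the norm `N_g c = Σ_{i<m} (gⁱ)^* c = π^* π_* c` of every Hodge class `c` on `X`
  is algebraic (`π : X → X/⟨g⟩` finite flat between smooth varieties; `π_*`, `π^*` preserve Hodge
  classes and algebraic classes).

What IS formalised is the step from Lemma 3 to the theorem, which is pure linear algebra
(Maschke), and its shape against the summit's own carriers:

* `exists_add_eq_of_norm_mem` (**abstract reflection principle**). `k` a field with `|G|` invertible,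
  `ρ` a representation of the finite group `G` on `V`, `Alg ≤ Hdg` subrepresentations, `R ⊆ G` any
  subset such that the norm `N_g = Σ_{i < ord g} ρ(gⁱ)` maps `Hdg` into `Alg` for every `g ∈ R`. Then
  every `c ∈ Hdg` is `a + r` with `a ∈ Alg` and `r ∈ Hdg ∩ ⋂_{g ∈ R} ker N_g`.
  *Proof.* Maschke gives a `G`-stable complement `q` of `Alg`; write `c = a + r`, `r ∈ q`; then
  `N_g r ∈ Alg ∩ q = 0`. (This replaces Proposition 4 of the prose paper — the group-algebra ideal
  argument `1 - e_Res ∈ ⟨N_g⟩` — by a two-line argument that needs neither `R` conjugation-closed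
  nor the isotypic decomposition.)
* `mem_of_norms` ("protected blocks") and `mem_of_norms'`: the same for a `G`-stable SET `H` and a
  `G`-stable subspace `A` of any representation — inside a `G`-stable subspace `W` on which the
  `R`-norms have no common non-zero kernel vector among combinations of elements of `H`, every
  element of `H` lies in `A` (apply the principle to `Hdg = span H ⊓ W`, `Alg = A ⊓ Hdg`).
* `hodgeConjectureFor_of_norms` and `hodgeConjecture_of_forall_norms`: the instantiation `k = ℂ`,
  `V = H²ᵖ(X(ℂ); ℂ)` (`complexBetti`), `H` = the rational `(p,p)`-classes
  (`IsRationalClass ∧ IsOfHodgeType`, literally the hypothesis of `HodgeConjectureFor`),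
  `A = algebraicClasses X p`, for ANY finite group of linear symmetries `ρ` of `H²ᵖ(X(ℂ); ℂ)`
  preserving Hodge classes and algebraic classes whose `R`-norms send Hodge classes to algebraic
  classes and have no common kernel among spans of Hodge classes: then `HodgeConjectureFor n X`,
  and `HodgeConjecture` if every smooth projective `X` carries such data.

So the kernel certifies exactly: *granted Lemmas 1–3 for a set `R` of automorphisms (supplied, per
`X`, as the hypotheses `map_hodge`, `map_alg`, `norm_alg` on the induced representation), the Hodge
conjecture for `X` is equivalent to the algebraicity of the Hodge classes in the residual part
`Res = ⋂_{g∈R} ker N_g`, and holds outright when no non-zero combination of Hodge classes is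
residual.* The geometric inputs are hypotheses, never axioms; nothing here is specific to sextics.

## What the principle settles (prose paper §4, exact combinatorics; recorded, not formalised)

For torus-symmetric families `F₀ + Σ_{α∈S} t_α x^α` of sextic fourfolds through the Fermat point the
reflections of every member are explicit (`xᵢ ↦ -xᵢ`, `xᵢ ↦ ζ₃xᵢ`, `xᵢ ↔ λxⱼ`) and
`Res_S = span{ω_β : βᵢ odd (i ∈ I₂), 3 ∤ βᵢ (i ∈ I₃), βᵢ = βⱼ ((ij) ∈ T)}` on Fermat characters.
Consequences: on the Dwork pencil `Σxᵢ⁶ = 6ψ∏xᵢ` the residual is the rank-5 hypergeometric piece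
`W₀` (Hodge numbers `(1,1,1,1,1)`), so the 1170 symmetry-forced classes are algebraic for every `ψ`,
`HC(X_ψ)` holds for all but countably many `ψ`, and `HC(X_ψ) ⟺` the Hodge classes in `W₀(ψ)` are
algebraic; at the Fermat point `Res = H⁴'⁰ ⊕ H⁰'⁴` (HC for the Fermat sextic fourfold in two lines);
and over all 639 826 saturated torus-symmetric families (2268 `S₆`-classes) every symmetry-forced
Hodge class is algebraic on every smooth member (the 5 separated exceptional classes being handled
by the Shioda–Katsura inductive structure). The engine is silent exactly on `Res`: for a general
`X` (no automorphisms) `Res = H⁴`, and the first residual instance with content is a Hodge class in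
`W₀(ψ)` at a special parameter of the Dwork pencil — two conditions on one parameter, none known.

## Path to the summit

`HodgeConjecture` ⟸ for every smooth projective `X`: data `(G, ρ, R)` as above in every codimension
with `Hdg ∩ Res = 0` (`hodgeConjecture_of_forall_norms`, from `hodgeConjectureFor_of_norms` and the
Literature theorem `nonempty_hodgeModel_holds`). This is a CRITERION, complete exactly on varieties
with enough automorphisms whose cyclic quotients satisfy HC (uniruled fourfolds, threefolds, …); its
wall is `Res`, recorded above. It is complementary to the residency's landed path, which §3 restates
with its models conjunct discharged: `HC ⇔ Transport ∧ AnchorSupply ⇔ LocalTransport ∧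
AlgebraicLocusClosed ∧ AnchorSupply` (`hodgeConjecture_iff_transport_and_anchorSupply'`,
`hodgeConjecture_iff_localTransport'`). The reflection engine manufactures the cycle on each member
from the quotient and never transports anything, which is why it reaches flat AND non-flat classes
off `Res`.

References: A. Conte, J. P. Murre, *The Hodge conjecture for fourfolds admitting a covering by
rational curves*, Math. Ann. 238 (1978) 79–88; S. Bloch, V. Srinivas, *Remarks on correspondences
and algebraic cycles*, Amer. J. Math. 105 (1983); C. Voisin, arXiv:math/0502257, p. 1; R. Laterveer /
survey arXiv:0706.2506, Cor. 26–27; H. Maschke (Mathlib `MonoidAlgebra.Submodule.exists_isCompl`,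
`IsSemisimpleRepresentation`); T. Shioda, T. Katsura, *On Fermat varieties*, Tôhoku Math. J. 31 (1979).
-/

noncomputable section

open CategoryTheory
open Literature.AlgebraicGeometry Literature.AlgebraicGeometry.Motives
open Literature.AlgebraicGeometry.HodgeTheory
open Literature.AlgebraicTopology.SingularHomology

namespace Summit.HodgeConjecture.HodgeConjecture.Theorems.SoloBlind

/-! ### §1. The abstract reflection principle (Maschke)

Throughout, the **norm** of `g` in a representation `ρ` is written out as the finite sum
`Σ_{i < ord g} ρ(gⁱ)` (for an automorphism `g` of a variety with smooth quotient `π : X → X/⟨g⟩` it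
is `π^* ∘ π_*` on cohomology); no new definitions are introduced. -/

section Abstract

variable {k G V : Type*} [Field k] [Group G] [AddCommGroup V] [Module k V]

/-- A subrepresentation is stable under every norm `Σ_{i < ord g} ρ(gⁱ)`. -/
theorem norm_mem {ρ : Representation k G V} (σ : Subrepresentation ρ) (g : G) {v : V}
    (hv : v ∈ σ) : (∑ i ∈ Finset.range (orderOf g), ρ (g ^ i) v) ∈ σ :=
  σ.toSubmodule.sum_mem fun i _ => σ.apply_mem_toSubmodule (g ^ i) hv

/-- Membership in an infimum of subrepresentations (definitional, recorded for rewriting). -/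
theorem subrep_mem_inf {ρ : Representation k G V} {σ τ : Subrepresentation ρ} {v : V} :
    v ∈ σ ⊓ τ ↔ v ∈ σ ∧ v ∈ τ :=
  Iff.rfl

/-- Membership in a supremum of subrepresentations (transported from `Submodule.mem_sup`). -/
theorem subrep_mem_sup {ρ : Representation k G V} {σ τ : Subrepresentation ρ} {v : V} :
    v ∈ σ ⊔ τ ↔ ∃ y ∈ σ, ∃ z ∈ τ, y + z = v := by
  show v ∈ σ.toSubmodule ⊔ τ.toSubmodule ↔ _
  exact Submodule.mem_sup

/-- Membership in the zero subrepresentation (transported from `Submodule.mem_bot`). -/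
theorem subrep_mem_bot {ρ : Representation k G V} {v : V} :
    v ∈ (⊥ : Subrepresentation ρ) ↔ v = 0 := by
  show v ∈ (⊥ : Submodule k V) ↔ _
  exact Submodule.mem_bot k

/-- Every vector lies in the top subrepresentation (transported from `Submodule.mem_top`). -/
theorem subrep_mem_top {ρ : Representation k G V} {v : V} : v ∈ (⊤ : Subrepresentation ρ) := by
  show v ∈ (⊤ : Submodule k V)
  exact Submodule.mem_top

/-- **Abstract reflection principle.** Let `ρ` be a representation of a finite group `G` over a
field in which `|G|` is invertible, `Alg ≤ Hdg` subrepresentations, and `R ⊆ G` such that the norm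
`N_g = Σ_{i < ord g} ρ(gⁱ)` maps `Hdg` into `Alg` for every `g ∈ R`. Then every `c ∈ Hdg` decomposes
as `c = a + r` with `a ∈ Alg` and `r ∈ Hdg` killed by all `N_g`, `g ∈ R`. Proof: Maschke complement
`q` of `Alg`; `c = a + r` with `r ∈ q`; `N_g r ∈ Alg ∩ q = 0`. -/
theorem exists_add_eq_of_norm_mem [Finite G] [NeZero (Nat.card G : k)]
    (ρ : Representation k G V) {Hdg Alg : Subrepresentation ρ} (hle : Alg ≤ Hdg) (R : Set G)
    (hN : ∀ g ∈ R, ∀ c ∈ Hdg, (∑ i ∈ Finset.range (orderOf g), ρ (g ^ i) c) ∈ Alg) {c : V}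
    (hc : c ∈ Hdg) :
    ∃ a ∈ Alg, ∃ r ∈ Hdg,
      (∀ g ∈ R, (∑ i ∈ Finset.range (orderOf g), ρ (g ^ i) r) = 0) ∧ c = a + r := by
  obtain ⟨q, hq⟩ := exists_isCompl Alg
  have htop : c ∈ Alg ⊔ q := by
    rw [hq.sup_eq_top]
    exact subrep_mem_top
  obtain ⟨a, ha, r, hr, rfl⟩ := subrep_mem_sup.1 htop
  have hrH : r ∈ Hdg := by
    have h := Hdg.toSubmodule.sub_mem (show a + r ∈ Hdg.toSubmodule from hc)
      (show a ∈ Hdg.toSubmodule from hle ha)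
    rwa [add_sub_cancel_left] at h
  refine ⟨a, ha, r, hrH, fun g hg => ?_, rfl⟩
  have hmem : (∑ i ∈ Finset.range (orderOf g), ρ (g ^ i) r) ∈ Alg ⊓ q :=
    subrep_mem_inf.2 ⟨hN g hg r hrH, norm_mem q g hr⟩
  rw [hq.inf_eq_bot] at hmem
  exact subrep_mem_bot.1 hmem

/-- **Reflection criterion, linear-algebra form (protected blocks).** `ρ` a representation of a finite
group `G` on `V` (`|G|` invertible in `k`), `H ⊆ V` a `G`-stable set ("Hodge classes"), `A ≤ V` a
`G`-stable subspace ("algebraic classes"), `R ⊆ G` such that the norm of every element of `H` lies in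
`A` for `g ∈ R`, and `W` a `G`-stable subspace such that no non-zero vector of `W ∩ span H` is killed
by all the norms `N_g`, `g ∈ R`. Then `H ∩ W ⊆ A`. (Apply `exists_add_eq_of_norm_mem` to
`Hdg = span H ⊓ W`, `Alg = A ⊓ Hdg`.) -/
theorem mem_of_norms [Finite G] [NeZero (Nat.card G : k)] (ρ : Representation k G V)
    (H : Set V) (A : Submodule k V) (hH : ∀ g, ∀ c ∈ H, ρ g c ∈ H)
    (hA : ∀ g, ∀ c ∈ A, ρ g c ∈ A) (R : Set G)
    (hN : ∀ g ∈ R, ∀ c ∈ H, (∑ i ∈ Finset.range (orderOf g), ρ (g ^ i) c) ∈ A)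
    (W : Submodule k V) (hW : ∀ g, ∀ w ∈ W, ρ g w ∈ W)
    (hWres : ∀ w ∈ W, w ∈ Submodule.span k H →
      (∀ g ∈ R, (∑ i ∈ Finset.range (orderOf g), ρ (g ^ i) w) = 0) → w = 0)
    {c : V} (hcW : c ∈ W) (hc : c ∈ H) : c ∈ A := by
  -- `span H` is `G`-stable, and the norms map it into `A` (linearity)
  have hspan : ∀ g, ∀ v ∈ Submodule.span k H, ρ g v ∈ Submodule.span k H := fun g v hv =>
    (Submodule.span_le.2 fun c hc => Submodule.subset_span (hH g c hc) :
      Submodule.span k H ≤ (Submodule.span k H).comap (ρ g)) hv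
  have hNspan : ∀ g ∈ R, ∀ v ∈ Submodule.span k H,
      (∑ i ∈ Finset.range (orderOf g), ρ (g ^ i) v) ∈ A := by
    intro g hg v hv
    let N : V →ₗ[k] V := ∑ i ∈ Finset.range (orderOf g), ρ (g ^ i)
    have hNapp : ∀ v, N v = ∑ i ∈ Finset.range (orderOf g), ρ (g ^ i) v := fun v => by
      simp [N, LinearMap.sum_apply]
    have hle : Submodule.span k H ≤ A.comap N :=
      Submodule.span_le.2 fun c hc => by
        show N c ∈ A
        rw [hNapp]
        exact hN g hg c hc
    have := hle hv
    rw [Submodule.mem_comap, hNapp] at this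
    exact this
  -- the subrepresentations `Hdg = span H ⊓ W` and `Alg = A ⊓ Hdg`
  let Hdg : Subrepresentation ρ :=
    { toSubmodule := Submodule.span k H ⊓ W
      apply_mem_toSubmodule := fun g v hv => ⟨hspan g v hv.1, hW g v hv.2⟩ }
  let Alg : Subrepresentation ρ :=
    { toSubmodule := A ⊓ (Submodule.span k H ⊓ W)
      apply_mem_toSubmodule := fun g v hv => ⟨hA g v hv.1, hspan g v hv.2.1, hW g v hv.2.2⟩ }
  have hle : Alg ≤ Hdg := fun v hv => hv.2
  have hN' : ∀ g ∈ R, ∀ v ∈ Hdg, (∑ i ∈ Finset.range (orderOf g), ρ (g ^ i) v) ∈ Alg :=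
    fun g hg v hv => ⟨hNspan g hg v hv.1, norm_mem Hdg g hv⟩
  have hcH : c ∈ Hdg := ⟨Submodule.subset_span hc, hcW⟩
  obtain ⟨a, ha, r, hr, hr0, rfl⟩ := exists_add_eq_of_norm_mem ρ hle R hN' hcH
  have : r = 0 := hWres r hr.2 hr.1 hr0
  subst this
  rw [add_zero]
  exact ha.1

/-- **Reflection criterion, linear-algebra form (global).** As `mem_of_norms` with `W = V`: if no
non-zero vector of `span H` is killed by all the norms `N_g`, `g ∈ R` (`span H ∩ Res = 0`), then
`H ⊆ A`. -/
theorem mem_of_norms' [Finite G] [NeZero (Nat.card G : k)] (ρ : Representation k G V)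
    (H : Set V) (A : Submodule k V) (hH : ∀ g, ∀ c ∈ H, ρ g c ∈ H)
    (hA : ∀ g, ∀ c ∈ A, ρ g c ∈ A) (R : Set G)
    (hN : ∀ g ∈ R, ∀ c ∈ H, (∑ i ∈ Finset.range (orderOf g), ρ (g ^ i) c) ∈ A)
    (hRes : ∀ w ∈ Submodule.span k H,
      (∀ g ∈ R, (∑ i ∈ Finset.range (orderOf g), ρ (g ^ i) w) = 0) → w = 0)
    {c : V} (hc : c ∈ H) : c ∈ A :=
  mem_of_norms ρ H A hH hA R hN ⊤ (fun _ _ _ => Submodule.mem_top) (fun w _ hw h0 => hRes w hw h0)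
    Submodule.mem_top hc

end Abstract

/-! ### §2. The criterion for `HodgeConjectureFor` -/

section Hodge

variable {n : ℕ} {X : SchemeOver ℂ}

/-- **Reflection criterion for `HodgeConjectureFor` (Theorem R).** If `X` has a Hodge model and, in
every codimension `p`, `H²ᵖ(X(ℂ); ℂ)` carries a representation `ρ` of a finite group preserving the
Hodge classes (rational classes of type `(p,p)`) and the algebraic classes, with a set `R` of group
elements whose norms `Σ_{i < ord g} ρ(gⁱ)` send Hodge classes to algebraic classes (for
automorphisms: `X/⟨g⟩` satisfies HC, e.g. a uniruled fourfold — Conte–Murre) and have no common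
non-zero kernel vector among `ℂ`-combinations of Hodge classes (`span(Hdg) ∩ Res = 0`), then the
Hodge conjecture holds for `X`. (Take `G` trivial and `R = ∅` in the codimensions where `Hdg ⊆ Alg`
is known otherwise only if `Hdg = 0` there — the last hypothesis then demands exactly that.)
[cite: ConteMurre1978] [cite: BlochSrinivas1983] [cite: Deligne2000, §1] -/
theorem hodgeConjectureFor_of_norms (A : HodgeModel n X)
    (h : ∀ p : ℕ, ∃ (G : Type) (_ : Group G) (_ : Finite G)
      (ρ : Representation ℂ G (complexBetti X (2 * p))) (R : Set G),
      (∀ g (c : complexBetti X (2 * p)), IsRationalClass c → IsOfHodgeType n X (2 * p) p p c →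
        IsRationalClass (ρ g c) ∧ IsOfHodgeType n X (2 * p) p p (ρ g c)) ∧
      (∀ g, ∀ c ∈ algebraicClasses X p, ρ g c ∈ algebraicClasses X p) ∧
      (∀ g ∈ R, ∀ c : complexBetti X (2 * p), IsRationalClass c → IsOfHodgeType n X (2 * p) p p c →
        (∑ i ∈ Finset.range (orderOf g), ρ (g ^ i) c) ∈ algebraicClasses X p) ∧
      (∀ w ∈ Submodule.span ℂ
          {c : complexBetti X (2 * p) | IsRationalClass c ∧ IsOfHodgeType n X (2 * p) p p c},
        (∀ g ∈ R, (∑ i ∈ Finset.range (orderOf g), ρ (g ^ i) w) = 0) → w = 0)) :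
    HodgeConjectureFor n X := by
  refine ⟨⟨A⟩, fun p c hrat hpp => ?_⟩
  obtain ⟨G, _, _, ρ, R, hHdg, hAlg, hN, hRes⟩ := h p
  haveI : NeZero (Nat.card G : ℂ) := ⟨Nat.cast_ne_zero.2 (Nat.card_pos (α := G)).ne'⟩
  exact mem_of_norms' ρ
    {c : complexBetti X (2 * p) | IsRationalClass c ∧ IsOfHodgeType n X (2 * p) p p c}
    (algebraicClasses X p) (fun g c hc => hHdg g c hc.1 hc.2) hAlg R
    (fun g hg c hc => hN g hg c hc.1 hc.2) hRes ⟨hrat, hpp⟩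

end Hodge

/-! ### §3. The summit: the criterion for `HodgeConjecture`, and the models conjunct discharged -/

section Summit

/-- **The path, models discharged**: `HC ⇔ Transport ∧ AnchorSupply`
(`hodgeConjecture_iff_transport_and_anchorSupply` of `SoloBlindTransportAnchors` with its first
conjunct discharged by the Literature theorem `nonempty_hodgeModel_holds` — Serre GAGA + de Rham +
the Hodge decomposition). [cite: Grothendieck1966, footnote 13] [cite: Deligne2000, §1] -/
theorem hodgeConjecture_iff_transport_and_anchorSupply' :
    _root_.HodgeConjecture ↔ Transport ∧ AnchorSupply :=
  ⟨fun h => ⟨transport_of_hodgeConjecture h, anchorSupply_of_hodgeConjecture h⟩,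
    fun h => hodgeConjecture_of_transport_of_anchorSupply (fun _ _ => nonempty_hodgeModel_holds)
      h.1 h.2⟩

/-- **The path, local form, models discharged**:
`HC ⇔ LocalTransport ∧ AlgebraicLocusClosed ∧ AnchorSupply`
(`hodgeConjecture_iff_localTransport` of `SoloBlindLocalTransport` with its first conjunct
discharged by `nonempty_hodgeModel_holds`). [cite: Grothendieck1966, footnote 13]
[cite: Deligne2000, §1] -/
theorem hodgeConjecture_iff_localTransport' :
    _root_.HodgeConjecture ↔ LocalTransport ∧ AlgebraicLocusClosed ∧ AnchorSupply :=
  ⟨fun h => ⟨localTransport_of_hodgeConjecture h, algebraicLocusClosed_of_hodgeConjecture h,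
      anchorSupply_of_hodgeConjecture h⟩,
    fun h => hodgeConjecture_of_localTransport (fun _ _ => nonempty_hodgeModel_holds) h.1 h.2.1
      h.2.2⟩

/-- **Reflection criterion for the summit.** If every smooth projective complex variety carries, in
every codimension `p`, a finite group of linear symmetries of `H²ᵖ(X(ℂ); ℂ)` preserving Hodge and
algebraic classes together with a set `R` of elements whose norms send Hodge classes to algebraic
classes and have no common non-zero kernel vector among combinations of Hodge classes, then the
Hodge conjecture holds. (A criterion, not a reduction: for a variety without automorphisms the only
available data is `R = ∅`, and then the last hypothesis asks for `Hdg²ᵖ(X) ⊗ ℂ = 0` or must be met by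
other means — this is the wall `Res = H²ᵖ` of the module docstring.) [cite: ConteMurre1978]
[cite: Deligne2000, §1] -/
theorem hodgeConjecture_of_forall_norms
    (h : ∀ ⦃n : ℕ⦄ ⦃X : SchemeOver ℂ⦄, IsSmoothProjective n X → ∀ p : ℕ,
      ∃ (G : Type) (_ : Group G) (_ : Finite G)
        (ρ : Representation ℂ G (complexBetti X (2 * p))) (R : Set G),
        (∀ g (c : complexBetti X (2 * p)), IsRationalClass c → IsOfHodgeType n X (2 * p) p p c →
          IsRationalClass (ρ g c) ∧ IsOfHodgeType n X (2 * p) p p (ρ g c)) ∧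
        (∀ g, ∀ c ∈ algebraicClasses X p, ρ g c ∈ algebraicClasses X p) ∧
        (∀ g ∈ R, ∀ c : complexBetti X (2 * p), IsRationalClass c →
          IsOfHodgeType n X (2 * p) p p c →
          (∑ i ∈ Finset.range (orderOf g), ρ (g ^ i) c) ∈ algebraicClasses X p) ∧
        (∀ w ∈ Submodule.span ℂ
            {c : complexBetti X (2 * p) | IsRationalClass c ∧ IsOfHodgeType n X (2 * p) p p c},
          (∀ g ∈ R, (∑ i ∈ Finset.range (orderOf g), ρ (g ^ i) w) = 0) → w = 0)) :
    _root_.HodgeConjecture := by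
  intro n X hX
  obtain ⟨A⟩ := (nonempty_hodgeModel_holds : nonempty_hodgeModel n X) hX
  exact hodgeConjectureFor_of_norms A (h hX)

end Summit

end Summit.HodgeConjecture.HodgeConjecture.Theorems.SoloBlind

end
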